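import Literature.Analysis.FluidPDE.TorusABCFlow
import Literature.Analysis.FluidPDE.SteadyNSLatticePersistence
import Summits.NavierStokesRegularity.FluidComputer.SkewCutCertificate
import Summits.NavierStokesRegularity.FluidComputer.AbcLinearisedLattice

/-!
# The strain pairing of the ABC linearisation: `|⟨(w·∇)U, w⟩| ≤ 2π√2 ‖w‖²` and its lattice form
(instab3 g4 — implementation 1 of the skew-cut X0 certifier, cell `ns-blowup`, 2026-08-26)

HONEST FRAMING (human ruling D-0035): nothing here is a claim about Navier–Stokes blow-up.
WHAT THIS IS NOT: not NS evidence. MODEL lane — the one ANALYTIC input about the linearised operator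
about the ABC flow `U = Torus.abcFlow 1 1 1` that the skew-cut certificates consume as the «pairing
bound» (SKEWCUT-CERT (F1)+(F2) with Lemma S, `s = √2`; KERNEL-CHAIN.md (A4): `Re⟨Av, v⟩ ≤ √2‖v‖²` in
period-`2π` units): on the unit torus, for every real field `w`,

  `∫ ⟪w, (U·∇)w⟫ = 0` (antisymmetry, `div U = 0`) and `|∫ ⟪w, (w·∇)U⟫| ≤ 2π√2 ∫ ‖w‖²`,

the latter from the POINTWISE bound `|vᵀ ∇U(x) v| ≤ 2π√2 |v|²` — the kernel Lemma S
`SkewCutCertificate.abc_strain_form_abs_le` (`|vᵀ S v| ≤ √2|v|²` for the period-`2π` strain) after the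
explicit partial derivatives of the ABC flow (§1) — and, by the finite Parseval identity, its LATTICE
form for conjugate-symmetric finitely supported coefficient families `c` (§4):

  `|∑_{k∈S} Re ⟪c k, N(â, c)(k) + N(c, â)(k)⟫| ≤ 2π√2 ∑_{k∈S} ‖c k‖²`,

i.e. (certifiers' form and units, transversal mean-free `c`, §5)
`|∑_{k∈S} Re ⟪c k, Π_k ∑_y â(q_y) × (i(k−q_y) × c(k−q_y) − c(k−q_y))⟫| ≤ √2 ∑_{k∈S} ‖c k‖²` —
the numerical range of the certifiers' advective matrix on real (conjugate-symmetric) families lies in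
`[−√2, √2]` (INSTAB3-METHOD §2 self-test S2 «numerical abscissa of the strain part ∈ [−√2, √2]», now a
theorem). Contents: §1 `partialDeriv_abcFlow_apply` (the nine partial derivatives of the ABC flow);
§2 `inner_fderiv_abcFlow` (`vᵀ∇U(x)v` in closed form), `abs_inner_fderiv_abcFlow_le` (Lemma S on `T³`);
§3 `integral_inner_convect_abcFlow_eq_zero`, `abs_integral_inner_stretch_abcFlow_le`,
`abs_integral_inner_linearised_abcFlow_le`; §4 `abs_sum_re_inner_linSym_abcFlow_le` (lattice form);
§5 `inner_lerayCoeff_of_transversal`, `abs_sum_re_inner_crossForm_abcFlow_le` (certifiers' form).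
Mathlib + Literature + `SkewCutCertificate` (Lemma S) + `AbcLinearisedLattice`; no definitions.
-/

noncomputable section

open scoped BigOperators Topology InnerProductSpace ComplexConjugate Matrix RealInnerProductSpace
open Filter Set Function MeasureTheory UnitAddTorus Finset

namespace Summit.NavierStokesRegularity.FluidComputer.AbcLinearisedPairing

open Literature.Analysis.FluidPDE Literature.Analysis.FluidPDE.SteadyLattice
open Literature.Analysis.FunctionSpaces Literature.Analysis.FunctionSpaces.Torus
open Literature.Analysis.FunctionSpaces.EuclideanSpace
open Literature.Analysis.FluidPDE.ScalarFourier

/-! ### §1 The partial derivatives of the ABC flow -/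

/-- The characters are unimodular: `‖e_n(x)‖ = 1`. -/
theorem norm_mFourier_pt (n : Fin 3 → ℤ) (x : UnitAddTorus (Fin 3)) : ‖mFourier n x‖ = 1 := by
  simp only [UnitAddTorus.mFourier, ContinuousMap.coe_mk, norm_prod]
  exact Finset.prod_eq_one fun i _ => by simp

/-- `abcDir (j, true) = eⱼ`. -/
theorem abcDir_true (j : Fin 3) : Torus.abcDir (j, true) = Pi.single j 1 := by
  simp [Torus.abcDir]

/-- `abcDir (j, false) = −eⱼ`. -/
theorem abcDir_false (j : Fin 3) : Torus.abcDir (j, false) = -Pi.single j 1 := by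
  rw [← abcDir_true, Torus.neg_abcDir]; rfl

/-- **Partial derivatives of the ABC flow on the unit torus**: with `a = abcAmp A B C = (B, C, A)` and
`eⱼ(x) = e^{2πixⱼ}` (`cos(2πxⱼ) = Re eⱼ(x)`, `sin(2πxⱼ) = Im eⱼ(x)`),
`∂ⱼ uᵢ(x) = 2π a_{i+2} cos(2πx_{i+2}) [j = i+2] − 2π a_{i+1} sin(2πx_{i+1}) [j = i+1]`
(from `uᵢ = a_{i+2} sin(2πx_{i+2}) + a_{i+1} cos(2πx_{i+1})`, MB (2.49)). -/
theorem partialDeriv_abcFlow_apply (A B C : ℝ) (j i : Fin 3) (x : UnitAddTorus (Fin 3)) :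
    partialDeriv j (Torus.abcFlow A B C) x i =
      2 * Real.pi * (if j = i + 2 then Torus.abcAmp A B C (i + 2) * (mFourier (Pi.single j (1 : ℤ)) x).re
        else 0) -
      2 * Real.pi * (if j = i + 1 then Torus.abcAmp A B C (i + 1) * (mFourier (Pi.single j (1 : ℤ)) x).im
        else 0) := by
  rw [Torus.abcFlow_eq_realTrigPoly, partialDeriv_realTrigPoly, realTrigPoly_apply_coord,
    trigPoly_apply_coord, Torus.sum_abcFreq, Fintype.sum_prod_type, Fin.sum_univ_three]
  simp only [Fintype.sum_bool, abcDir_true, abcDir_false, mFourier_neg]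
  fin_cases i <;> fin_cases j <;>
    simp [Torus.abcCoeff_apply, Torus.abcAmp, Fin.isValue, Complex.mul_re, Complex.mul_im,
      Complex.conj_re, Complex.conj_im] <;> ring


/-! ### §2 The strain quadratic form `vᵀ ∇U(x) v` and its pointwise bound (Lemma S on the torus) -/

/-- **The quadratic form of the velocity gradient of the ABC flow**: for `v ∈ ℝ³` and `x ∈ T³`,
`⟪v, DU(x) v⟫
  = 2π [ (B cos X₀ − C sin X₁) v₀v₁ + (A cos X₂ − B sin X₀) v₀v₂ + (C cos X₁ − A sin X₂) v₁v₂ ]`,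
`cos Xⱼ = Re eⱼ(x)`, `sin Xⱼ = Im eⱼ(x)` — only the symmetric part (the strain) of `DU` is seen. -/
theorem inner_fderiv_abcFlow (A B C : ℝ) (x : UnitAddTorus (Fin 3)) (v : EuclideanSpace ℝ (Fin 3)) :
    ⟪v, Torus.fderiv (Torus.abcFlow A B C) x v⟫_ℝ =
      2 * Real.pi * ((B * (mFourier (Pi.single (0 : Fin 3) (1 : ℤ)) x).re -
          C * (mFourier (Pi.single (1 : Fin 3) (1 : ℤ)) x).im) * v 0 * v 1 +
        (A * (mFourier (Pi.single (2 : Fin 3) (1 : ℤ)) x).re -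
          B * (mFourier (Pi.single (0 : Fin 3) (1 : ℤ)) x).im) * v 0 * v 2 +
        (C * (mFourier (Pi.single (1 : Fin 3) (1 : ℤ)) x).re -
          A * (mFourier (Pi.single (2 : Fin 3) (1 : ℤ)) x).im) * v 1 * v 2) := by
  have hU : IsContDiff 1 (Torus.abcFlow A B C) := (Torus.isSmooth_abcFlow A B C).isContDiff (by simp)
  rw [fderiv_apply_eq_sum_partialDeriv hU x v, PiLp.inner_apply, Fin.sum_univ_three]
  simp only [Fin.sum_univ_three, PiLp.add_apply, PiLp.smul_apply, smul_eq_mul, partialDeriv_abcFlow_apply,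
    RCLike.inner_apply, conj_trivial]
  simp [Torus.abcAmp, Fin.isValue]
  ring

/-- **Lemma S on the unit torus**: `|⟪v, DU(x) v⟫| ≤ 2π√2 ‖v‖²` for the ABC flow `A = B = C = 1`
(the kernel Lemma S `SkewCutCertificate.abc_strain_form_abs_le`, `|vᵀSv| ≤ √2|v|²` for the period-`2π`
strain, at the angles `Xⱼ = arg eⱼ(x)`; the factor `2π` is the unit-torus rescaling of `∇`). -/
theorem abs_inner_fderiv_abcFlow_le (x : UnitAddTorus (Fin 3)) (v : EuclideanSpace ℝ (Fin 3)) :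
    |⟪v, Torus.fderiv (Torus.abcFlow 1 1 1) x v⟫_ℝ| ≤ 2 * Real.pi * Real.sqrt 2 * ‖v‖ ^ 2 := by
  rw [inner_fderiv_abcFlow]
  -- the angles
  have hcs : ∀ j : Fin 3, Real.cos (Complex.arg (mFourier (Pi.single j (1 : ℤ)) x)) =
      (mFourier (Pi.single j (1 : ℤ)) x).re ∧ Real.sin (Complex.arg (mFourier (Pi.single j (1 : ℤ)) x)) =
      (mFourier (Pi.single j (1 : ℤ)) x).im := by
    intro j
    have h1 : ‖mFourier (Pi.single j (1 : ℤ)) x‖ = 1 := norm_mFourier_pt _ x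
    have h0 : mFourier (Pi.single j (1 : ℤ)) x ≠ 0 := by
      intro h; rw [h, norm_zero] at h1; exact zero_ne_one h1
    rw [Complex.cos_arg h0, Complex.sin_arg, h1, div_one, div_one]
    exact ⟨rfl, rfl⟩
  obtain ⟨hc0, hs0⟩ := hcs 0
  obtain ⟨hc1, hs1⟩ := hcs 1
  obtain ⟨hc2, hs2⟩ := hcs 2
  have hS := SkewCutCertificate.abc_strain_form_abs_le (Complex.arg (mFourier (Pi.single (0 : Fin 3) (1 : ℤ)) x))
    (Complex.arg (mFourier (Pi.single (1 : Fin 3) (1 : ℤ)) x))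
    (Complex.arg (mFourier (Pi.single (2 : Fin 3) (1 : ℤ)) x))
    (v 0) (v 1) (v 2)
  rw [hc0, hs0, hc1, hs1, hc2, hs2] at hS
  have hn : ‖v‖ ^ 2 = v 0 ^ 2 + v 1 ^ 2 + v 2 ^ 2 := by
    rw [EuclideanSpace.norm_sq_eq, Fin.sum_univ_three]
    simp only [Real.norm_eq_abs, sq_abs]
  rw [hn, one_mul, one_mul, one_mul, one_mul, one_mul, one_mul, abs_mul, abs_of_pos Real.two_pi_pos]
  have key : ∀ {Q T : ℝ}, |Q| ≤ Real.sqrt 2 * T → 2 * Real.pi * |Q| ≤ 2 * Real.pi * Real.sqrt 2 * T :=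
    fun {Q T} h => by
      calc 2 * Real.pi * |Q| ≤ 2 * Real.pi * (Real.sqrt 2 * T) := mul_le_mul_of_nonneg_left h Real.two_pi_pos.le
        _ = 2 * Real.pi * Real.sqrt 2 * T := by ring
  refine key ?_
  convert hS using 2
  ring

/-! ### §3 The two integrated pairings for real fields: transport is antisymmetric, stretching obeys Lemma S -/

/-- **Antisymmetry of transport**: `∫ ⟪w, (U·∇)w⟫ = 0` for the (divergence-free) ABC flow and every
smooth real field `w` (SKEWCUT-CERT (F1) for the `U·∇` part). -/
theorem integral_inner_convect_abcFlow_eq_zero (A B C : ℝ) {w : UnitAddTorus (Fin 3) → EuclideanSpace ℝ (Fin 3)}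
    (hw : IsSmooth w) : ∫ x, ⟪w x, convect (Torus.abcFlow A B C) w x⟫_ℝ = 0 := by
  have h := integral_inner_convect_eq_neg (Torus.isSmooth_abcFlow A B C) (Torus.isDivFree_abcFlow A B C) hw hw
  have hsym : ∫ x, ⟪convect (Torus.abcFlow A B C) w x, w x⟫_ℝ =
      ∫ x, ⟪w x, convect (Torus.abcFlow A B C) w x⟫_ℝ :=
    integral_congr_ae (Filter.Eventually.of_forall fun x => real_inner_comm _ _)
  rw [hsym] at h
  linarith

/-- **The stretching pairing obeys Lemma S**: `|∫ ⟪w, (w·∇)U⟫| ≤ 2π√2 ∫ ‖w‖²` for `U = abcFlow 1 1 1`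
and every smooth real field `w` (SKEWCUT-CERT (F2) + Lemma S). -/
theorem abs_integral_inner_stretch_abcFlow_le {w : UnitAddTorus (Fin 3) → EuclideanSpace ℝ (Fin 3)}
    (hw : IsSmooth w) :
    |∫ x, ⟪w x, convect w (Torus.abcFlow 1 1 1) x⟫_ℝ| ≤ 2 * Real.pi * Real.sqrt 2 * ∫ x, ‖w x‖ ^ 2 := by
  have hpt : ∀ x, |⟪w x, convect w (Torus.abcFlow 1 1 1) x⟫_ℝ| ≤ 2 * Real.pi * Real.sqrt 2 * ‖w x‖ ^ 2 :=
    fun x => abs_inner_fderiv_abcFlow_le x (w x)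
  have hint : Integrable (fun x => ‖w x‖ ^ 2) volume := (hw.continuous.norm.pow 2).integrable_unitAddTorus
  calc |∫ x, ⟪w x, convect w (Torus.abcFlow 1 1 1) x⟫_ℝ|
      ≤ ∫ x, |⟪w x, convect w (Torus.abcFlow 1 1 1) x⟫_ℝ| := by
        rw [← Real.norm_eq_abs]
        exact (norm_integral_le_integral_norm _).trans (le_of_eq (integral_congr_ae
          (Filter.Eventually.of_forall fun x => Real.norm_eq_abs _)))
    _ ≤ ∫ x, 2 * Real.pi * Real.sqrt 2 * ‖w x‖ ^ 2 := by
        refine integral_mono_of_nonneg (Filter.Eventually.of_forall fun x => abs_nonneg _)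
          (hint.const_mul _) (Filter.Eventually.of_forall hpt)
    _ = 2 * Real.pi * Real.sqrt 2 * ∫ x, ‖w x‖ ^ 2 := integral_const_mul _ _

/-- **The full linearised pairing**: `|∫ ⟪w, (U·∇)w + (w·∇)U⟫| ≤ 2π√2 ∫ ‖w‖²` for `U = abcFlow 1 1 1`
and every smooth real `w` — `Re ⟨(−A) v, v⟩`-type bound of KERNEL-CHAIN (A4) in unit-torus units. -/
theorem abs_integral_inner_linearised_abcFlow_le {w : UnitAddTorus (Fin 3) → EuclideanSpace ℝ (Fin 3)}
    (hw : IsSmooth w) :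
    |∫ x, ⟪w x, convect (Torus.abcFlow 1 1 1) w x + convect w (Torus.abcFlow 1 1 1) x⟫_ℝ| ≤
      2 * Real.pi * Real.sqrt 2 * ∫ x, ‖w x‖ ^ 2 := by
  have hU := Torus.isSmooth_abcFlow 1 1 1
  have i1 : Integrable (fun x => ⟪w x, convect (Torus.abcFlow 1 1 1) w x⟫_ℝ) volume :=
    (hw.continuous.inner (hU.convect hw).continuous).integrable_unitAddTorus
  have i2 : Integrable (fun x => ⟪w x, convect w (Torus.abcFlow 1 1 1) x⟫_ℝ) volume :=
    (hw.continuous.inner (hw.convect hU).continuous).integrable_unitAddTorus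
  simp_rw [inner_add_right]
  rw [integral_add i1 i2, integral_inner_convect_abcFlow_eq_zero 1 1 1 hw, zero_add]
  exact abs_integral_inner_stretch_abcFlow_le hw


/-! ### §4 The lattice form: the numerical range of the linearised convective symbol on real families -/

/-- **The pairing bound on the Fourier lattice** (finite Parseval): for a conjugate-symmetric family
`c : ℤ³ → ℂ³` supported in a symmetric finite `S` (a real trigonometric polynomial `w = Re ∑ e_k c(k)`),
the linearised convective symbol `M(c)(k) = N(â, c)(k) + N(c, â)(k)` about `U = abcFlow 1 1 1` satisfies
`|∑_{k∈S} Re ⟪c k, M(c)(k)⟫| ≤ 2π√2 ∑_{k∈S} ‖c k‖²` — the Fourier side of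
`∫⟪w, (U·∇)w + (w·∇)U⟫`, transport antisymmetric and stretching bounded by Lemma S. -/
theorem abs_sum_re_inner_linSym_abcFlow_le {S : Finset (Fin 3 → ℤ)} (hS : ∀ k ∈ S, -k ∈ S)
    {c : (Fin 3 → ℤ) → EuclideanSpace ℂ (Fin 3)} (hc : IsConjSymm c) (hsupp : ∀ k ∉ S, c k = 0) :
    |∑ k ∈ S, (⟪c k, (WithLp.toLp 2 (fun pp : Fin 3 => transportSym (fun jj mm => (mFourierCoeff (complexify
        ∘ Torus.abcFlow 1 1 1)) mm jj) (fun mm => c mm pp) k) : EuclideanSpace ℂ (Fin 3)) +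
      (WithLp.toLp 2 (fun pp : Fin 3 => transportSym (fun jj mm => c mm jj) (fun mm => (mFourierCoeff
        (complexify ∘ Torus.abcFlow 1 1 1)) mm pp) k) : EuclideanSpace ℂ (Fin 3))⟫_ℂ).re| ≤
      2 * Real.pi * Real.sqrt 2 * ∑ k ∈ S, ‖c k‖ ^ 2 := by
  set U := Torus.abcFlow 1 1 1 with hUdef
  have hU : IsSmooth U := Torus.isSmooth_abcFlow 1 1 1
  set w : UnitAddTorus (Fin 3) → EuclideanSpace ℝ (Fin 3) := realTrigPoly S c with hwdef
  have hw : IsSmooth w := isSmooth_realTrigPoly S c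
  have hŵ : mFourierCoeff (complexify ∘ w) = c := by
    funext k
    rw [hwdef, mFourierCoeff_realTrigPoly hS hc]
    split_ifs with hk
    · rfl
    · exact (hsupp k hk).symm
  -- the linearised field `F = (U·∇)w + (w·∇)U` and its coefficients
  set F : UnitAddTorus (Fin 3) → EuclideanSpace ℝ (Fin 3) := fun x => convect U w x + convect w U x with hFdef
  have hF : IsSmooth F := (hU.convect hw).add (hw.convect hU)
  have hMF : ∀ k, (WithLp.toLp 2 (fun pp : Fin 3 => transportSym (fun jj mm => (mFourierCoeff (complexify
        ∘ U)) mm jj) (fun mm => c mm pp) k) : EuclideanSpace ℂ (Fin 3)) +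
      (WithLp.toLp 2 (fun pp : Fin 3 => transportSym (fun jj mm => c mm jj) (fun mm => (mFourierCoeff
        (complexify ∘ U)) mm pp) k) : EuclideanSpace ℂ (Fin 3)) = mFourierCoeff (complexify ∘ F) k := by
    intro k
    have e : complexify ∘ F = (complexify ∘ convect U w) + (complexify ∘ convect w U) := by
      funext x
      simp only [hFdef, Function.comp_apply, Pi.add_apply, map_add]
    rw [e, mFourierCoeff_add (hU.convect hw).complexify_comp.integrable (hw.convect hU).complexify_comp.integrable,
      mFourierCoeff_convect_real hU hw k, mFourierCoeff_convect_real hw hU k, hŵ]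
  simp_rw [hMF]
  rw [← integral_inner_realTrigPoly_left hS hc (hF.memLp 2), ← integral_norm_sq_realTrigPoly hS hc]
  exact abs_integral_inner_linearised_abcFlow_le hw


/-! ### §5 The certifiers' form: the numerical range of `P[U × (curl v − v)]` lies in `[−√2, √2]` -/

/-- Transversal coefficients do not see the Leray multiplier: `⟪c, Π_k v⟫ = ⟪c, v⟫` when `k·c = 0`
and `k ≠ 0`. -/
theorem inner_lerayCoeff_of_transversal {k : Fin 3 → ℤ} (hk : k ≠ 0) {c : EuclideanSpace ℂ (Fin 3)}
    (hct : (∑ jj : Fin 3, ((k jj : ℤ) : ℂ) * c jj) = 0) (v : EuclideanSpace ℂ (Fin 3)) :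
    ⟪c, Torus.lerayCoeff k v⟫_ℂ = ⟪c, v⟫_ℂ := by
  have h0 : ⟪c, Torus.freqVec k⟫_ℂ = 0 := by
    rw [PiLp.inner_apply]
    simp only [Torus.freqVec_apply, RCLike.inner_apply]
    have : (∑ jj : Fin 3, ((k jj : ℤ) : ℂ) * (starRingEnd ℂ) (c jj)) =
        (starRingEnd ℂ) (∑ jj : Fin 3, ((k jj : ℤ) : ℂ) * c jj) := by
      rw [map_sum]
      exact Finset.sum_congr rfl fun jj _ => by rw [map_mul, map_intCast]
    rw [this, hct, map_zero]
  rw [Torus.lerayCoeff_of_ne_zero hk, Torus.leraySym_def, inner_sub_right, inner_smul_right, h0, mul_zero,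
    sub_zero]

/-- **Numerical range of the certifiers' advective matrix on real families.** For `U = abcFlow 1 1 1` and
a conjugate-symmetric, transversal, mean-free family `c` supported in a symmetric finite `S`, the
certifiers' operator `(A c)(k) = Π_k ∑_y â(q_y) × (i(k − q_y) × c(k − q_y) − c(k − q_y))`
(`= P[U × (curl v − v)]` in period-`2π` units, INSTAB3-METHOD §1) satisfies
`|∑_{k∈S} Re ⟪c k, (A c)(k)⟫| ≤ √2 ∑_{k∈S} ‖c k‖²` — SKEWCUT-CERT (F1)+(F2) with Lemma S, `s = √2`
(KERNEL-CHAIN (A4) «pairing bound `Re⟨Av, v⟩ ≤ √2‖v‖²`», both signs, real / conjugate-symmetric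
families, i.e. the REAL Galerkin matrices the two certifiers assemble). -/
theorem abs_sum_re_inner_crossForm_abcFlow_le {S : Finset (Fin 3 → ℤ)} (hS : ∀ k ∈ S, -k ∈ S)
    {c : (Fin 3 → ℤ) → EuclideanSpace ℂ (Fin 3)} (hc : IsConjSymm c)
    (hct : ∀ k : Fin 3 → ℤ, (∑ jj : Fin 3, ((k jj : ℤ) : ℂ) * (c k) jj) = 0) (hc0 : c 0 = 0)
    (hsupp : ∀ k ∉ S, c k = 0) :
    |∑ k ∈ S, (⟪c k, Torus.lerayCoeff k (∑ y : Fin 3 × Bool,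
        WithLp.toLp 2 (WithLp.ofLp (Torus.abcCoeff 1 1 1 (Torus.abcDir y)) ⨯₃
          (Complex.I • ((fun j : Fin 3 => (((k - Torus.abcDir y) j : ℤ) : ℂ)) ⨯₃
            WithLp.ofLp (c (k - Torus.abcDir y))) - WithLp.ofLp (c (k - Torus.abcDir y)))))⟫_ℂ).re| ≤
      Real.sqrt 2 * ∑ k ∈ S, ‖c k‖ ^ 2 := by
  have hπ : (2 * Real.pi : ℝ) ≠ 0 := ne_of_gt Real.two_pi_pos
  -- each term is `−(2π)⁻¹ Re ⟪c k, M(c)(k)⟫`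
  have hterm : ∀ k, (⟪c k, Torus.lerayCoeff k (∑ y : Fin 3 × Bool,
        WithLp.toLp 2 (WithLp.ofLp (Torus.abcCoeff 1 1 1 (Torus.abcDir y)) ⨯₃
          (Complex.I • ((fun j : Fin 3 => (((k - Torus.abcDir y) j : ℤ) : ℂ)) ⨯₃
            WithLp.ofLp (c (k - Torus.abcDir y))) - WithLp.ofLp (c (k - Torus.abcDir y)))))⟫_ℂ).re =
      -(2 * Real.pi)⁻¹ * (⟪c k, (WithLp.toLp 2 (fun pp : Fin 3 => transportSym (fun jj mm => (mFourierCoeff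
        (complexify ∘ Torus.abcFlow 1 1 1)) mm jj) (fun mm => c mm pp) k) : EuclideanSpace ℂ (Fin 3)) +
      (WithLp.toLp 2 (fun pp : Fin 3 => transportSym (fun jj mm => c mm jj) (fun mm => (mFourierCoeff
        (complexify ∘ Torus.abcFlow 1 1 1)) mm pp) k) : EuclideanSpace ℂ (Fin 3))⟫_ℂ).re := by
    intro k
    have hx := AbcLinearisedLattice.lerayCoeff_linSym_abcFlow_eq_cross 1 1 1 c k
    have h2 : (-(2 * Real.pi) : ℂ) ≠ 0 := by
      rw [neg_ne_zero]; exact_mod_cast hπ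
    have hcross := (eq_inv_smul_iff₀ h2).mpr hx.symm
    rw [hcross, inner_smul_right]
    by_cases hk : k = 0
    · subst hk
      simp [hc0]
    · rw [inner_lerayCoeff_of_transversal hk (hct k)]
      rw [show ((-(2 * Real.pi) : ℂ))⁻¹ = (((-(2 * Real.pi))⁻¹ : ℝ) : ℂ) by push_cast; ring,
        Complex.re_ofReal_mul]
      ring
  simp_rw [hterm]
  rw [← Finset.mul_sum, abs_mul, abs_neg, abs_inv, abs_of_pos Real.two_pi_pos]
  have h := abs_sum_re_inner_linSym_abcFlow_le hS hc hsupp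
  calc (2 * Real.pi)⁻¹ * |∑ k ∈ S, (⟪c k, (WithLp.toLp 2 (fun pp : Fin 3 => transportSym (fun jj mm =>
        (mFourierCoeff (complexify ∘ Torus.abcFlow 1 1 1)) mm jj) (fun mm => c mm pp) k) : EuclideanSpace ℂ
        (Fin 3)) + (WithLp.toLp 2 (fun pp : Fin 3 => transportSym (fun jj mm => c mm jj) (fun mm =>
        (mFourierCoeff (complexify ∘ Torus.abcFlow 1 1 1)) mm pp) k) : EuclideanSpace ℂ (Fin 3))⟫_ℂ).re|
      ≤ (2 * Real.pi)⁻¹ * (2 * Real.pi * Real.sqrt 2 * ∑ k ∈ S, ‖c k‖ ^ 2) :=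
        mul_le_mul_of_nonneg_left h (inv_nonneg.mpr Real.two_pi_pos.le)
    _ = Real.sqrt 2 * ∑ k ∈ S, ‖c k‖ ^ 2 := by field_simp

end Summit.NavierStokesRegularity.FluidComputer.AbcLinearisedPairing

end
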